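import Summits.QuantumFields.YangMills.Theorems.OneCertifiedCubeFiniteSizeCriterion
import Summits.QuantumFields.YangMills.Theorems.LangevinControlUVOSLegsFromFemtoAndGapDefs
import Summits.QuantumFields.YangMills.Theses.BalabanLadder
import Summits.QuantumFields.YangMills.Theorems.BalabanLadderIRStubShellRung
import Summits.QuantumFields.YangMills.Theorems.BalabanLadderIRStrongCouplingTV
import Summits.QuantumFields.YangMills.Theorems.BalabanLadderIROuterToTV
import Literature.MathematicalPhysics.QuantumLattice.GaugeGroupsProofs

/-!
# `¬ OuterCertificate` modulo a boundary-order wire (Q-g18 typed kill attempt on v10 `stub_outerCert`)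

Target: skeleton v10 (`IR_birth_cell_v10.lean`, sha 88d42543849b7401) of crux `IR`
(item stmt-QuantumFields-19354, route BalabanLadder), open stub
`stub_outerCert : IROuterCertificate`.  The three definitions `OuterTemperedCond`, `OuterCertificate`,
`IROuterCertificate` below are VERBATIM copies of v10 :76 / :185 / :249 (v10 is not a tree module, so
it cannot be imported; the copies are definitionally the v10 bodies).

Findings (kernel-checked here):

* `nt_witness_of_not_irOuterCertificate` — an UNCONDITIONAL `¬ IROuterCertificate` hands out a compact
  simple `G`, a lattice representation `r` and an admissible unit map `a` with `LowerBounds G r a`, i.e. a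
  non-triviality witness of the NT shape.  No junk / degenerate instance can supply one (`LowerBounds`
  carries `0 < ε`), so an unconditional kill is at least as hard as non-triviality: NOT available.
* `not_outerTemperedCond_of_wireAt` — the typed boundary-order wire at one parameter point kills the
  outer-tempered condition (i♭)+(ii) at that point for every `ε < 1/3`: the rarity clause (ii) forces every
  admissible `Good` on the cap cell to meet both phase-selecting sets of cap data (each of kernel mass
  `> δ`), the splice of a good cap datum into the common wall datum is good (`DependsOn`), distinct cells of
  a frame have disjoint edge sets, and clause (i♭) then bounds an order-parameter jump `≥ 1/3` by `ε`.
* `outerCertificate_false_of_wire` — `BoundaryOrderWire r.ρ → (∀ β, 0 < a β) → a → 0 → ¬ OuterCertificate r a`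
  (bookkeeping: `ε·M(n) < 1` with `M(n) ≥ 16` gives `ε < 1/3`; `⌈ℓ/a β⌉₊ → ∞` supplies `b ≥ b₀`).
* `irOuterCertificate_false_of_witness` — the #31 shape: a non-trivial `(G, r, a)` whose Wilson kernels
  carry a wire refutes `IROuterCertificate`; `irOuterCertificate_false_of_nt_of_wireSU2` — with the
  route's `NT` and a wire for every lattice representation of `SU(2)`, `IROuterCertificate` is false.

`BoundaryOrderWire ρ` (the typed hypothesis H): ONE rarity level `δ > 0`, thresholds `b₀, β₀`, and for
all cell sizes `b ≥ b₀`, couplings `β ≥ β₀` and window radii `n ≥ 1`: a frame `w` of mesh `b`, a tube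
`Y ⊆ windowCells n` through the centre, an outer-shell cap cell `cs`, a wall datum `σW`, a `[0,1]`-valued
measurable cylinder `f` on the centre cell, and two sets `S₀, S₁` of cap data, each of mass `> δ` under one
Wilson kernel containing the cap cell, such that splicing a cap datum from `S₀` (resp. `S₁`) into `σW`
drives `∫ f` under the tube kernel below `1/3` (resp. above `2/3`) — boundary-selected long-range order
along a frozen-wall tube of `2n` cells of side `b → ∞` lattice units at fixed `β` (card
`boundary-order-wire`, certideate-2).  H is NOT proved here (it is a statement about 4-D `SU(2)` lattice
gauge theory at weak coupling); the lattice-scale toy is kit job j253739.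
-/

noncomputable section

open Filter Topology MeasureTheory
open Literature.MathematicalPhysics.QuantumFieldTheory Literature.MathematicalPhysics.QuantumLattice
open Summit.QuantumFields.YangMills.Cruxes.OSLegsFromFemtoAndGap.DlrCollarTransfer (GapInUnits LowerBounds)
open Summit.QuantumFields.YangMills.Cruxes.IR.Tempered (cellEdges windowCells regionEdges)
open Summit.QuantumFields.YangMills.Cruxes.IR.ShellTempered (windowCellsPlus)

namespace Summit.QuantumFields.YangMills.Cruxes.IR.OuterCertWire

/-! ## §1 Verbatim copies of the v10 definitions -/

section Defs

variable {G : Type} [Group G] [TopologicalSpace G] [IsTopologicalGroup G] [CompactSpace G]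
  [MeasurableSpace G] [BorelSpace G]

/-- v10 :76, verbatim: the outer-tempered finite-size condition at `(ρ, β, b, n, ε, δ)`. -/
def OuterTemperedCond {N : ℕ} (ρ : G →* Matrix (Fin N) (Fin N) ℂ) (β : ℝ) (b n : ℕ) (ε δ : ℝ) : Prop :=
  ∀ w : Fin 4 → ℤ → ℤ, (∀ i j, w i j + ((b : ℕ) : ℤ) ≤ w i (j + 1) ∧ w i (j + 1) ≤ w i j + 2 * ((b : ℕ) : ℤ)) →
    ∃ Good : (Fin 4 → ℤ) → Set (LGConfig 4 G),
      (∀ c, MeasurableSet (Good c)) ∧ (∀ c, DependsOn (fun σ : LGConfig 4 G => σ ∈ Good c) ↑(cellEdges w c)) ∧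
      (∀ Y : Finset (Fin 4 → ℤ), Y ⊆ windowCells n → (0 : Fin 4 → ℤ) ∈ Y →
        ∀ σ σ' : LGConfig 4 G,
          (∀ c ∈ windowCellsPlus n, c ∉ Y →
            ((∀ e ∈ cellEdges w c, σ e = σ' e) ∨ (c ∉ windowCells n ∧ σ ∈ Good c ∧ σ' ∈ Good c))) →
          ∀ f : LGConfig 4 G → ℝ, IsCylinder f (cellEdges w 0) → Measurable f → (∀ U, 0 ≤ f U ∧ f U ≤ 1) →
            |(∫ U, f U ∂(ymSpecification ρ β (regionEdges w Y) σ)) -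
              ∫ U, f U ∂(ymSpecification ρ β (regionEdges w Y) σ')| ≤ ε) ∧
      (∀ c : Fin 4 → ℤ, ∀ E' : Finset (Literature.MathematicalPhysics.QuantumLattice.ZdEdge 4), cellEdges w c ⊆ E' →
        ∀ ζ : LGConfig 4 G, (ymSpecification ρ β E' ζ) (Good c)ᶜ ≤ ENNReal.ofReal δ)

/-- v10 :185, verbatim: the outer-tempered calibrated certificate for `(G, r, a)`. -/
def OuterCertificate (r : LatticeRep G) (a : ℝ → ℝ) : Prop :=
  ∃ ℓ : ℝ, 0 < ℓ ∧ ∃ (n : ℕ) (ε : ℝ), 1 ≤ n ∧ 0 ≤ ε ∧ ε * ((((4 * n + 3) ^ 4 - (4 * n + 1) ^ 4 : ℕ)) : ℝ) < 1 ∧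
    ∀ δ : ℝ, 0 < δ → ∃ β₂ : ℝ, ∀ β : ℝ, β₂ ≤ β → OuterTemperedCond r.ρ β ⌈ℓ / a β⌉₊ n ε δ

/-! ## §2 The typed hypothesis: a boundary-order wire -/

/-- Splice: the datum equal to `τ` on the edges of cell `cs` of frame `w` and to `σW` elsewhere. -/
def splice (w : Fin 4 → ℤ → ℤ) (cs : Fin 4 → ℤ) (σW τ : LGConfig 4 G) : LGConfig 4 G :=
  fun e => if e ∈ cellEdges w cs then τ e else σW e

/-- **Boundary-order wire at one parameter point** `(ρ, β, b, n, δ)`: a frame `w` of mesh `b`, a tube of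
cells `Y ⊆ windowCells n` containing the centre, a cap cell `cs` in the outer shell, a wall datum `σW`, a
`[0,1]`-valued measurable centre-cell cylinder `f`, and two phase-selecting sets `S₀, S₁` of cap data, each
of mass `> δ` under one Wilson kernel `γ_{E₀}(·|ζ₀)` with `cellEdges w cs ⊆ E₀`, such that every cap datum
from `S₀` spliced into `σW` gives `∫ f dγ_{regionEdges w Y} ≤ 1/3` and every one from `S₁` gives `≥ 2/3`. -/
def WireAt {N : ℕ} (ρ : G →* Matrix (Fin N) (Fin N) ℂ) (β : ℝ) (b n : ℕ) (δ : ℝ) : Prop :=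
  ∃ w : Fin 4 → ℤ → ℤ, (∀ i j, w i j + ((b : ℕ) : ℤ) ≤ w i (j + 1) ∧ w i (j + 1) ≤ w i j + 2 * ((b : ℕ) : ℤ)) ∧
    ∃ (Y : Finset (Fin 4 → ℤ)) (cs : Fin 4 → ℤ) (σW : LGConfig 4 G) (f : LGConfig 4 G → ℝ)
      (E₀ : Finset (Literature.MathematicalPhysics.QuantumLattice.ZdEdge 4)) (ζ₀ : LGConfig 4 G) (S₀ S₁ : Set (LGConfig 4 G)),
      Y ⊆ windowCells n ∧ (0 : Fin 4 → ℤ) ∈ Y ∧ cs ∈ windowCellsPlus n ∧ cs ∉ windowCells n ∧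
      IsCylinder f (cellEdges w 0) ∧ Measurable f ∧ (∀ U, 0 ≤ f U ∧ f U ≤ 1) ∧
      cellEdges w cs ⊆ E₀ ∧
      ENNReal.ofReal δ < ymSpecification ρ β E₀ ζ₀ S₀ ∧ ENNReal.ofReal δ < ymSpecification ρ β E₀ ζ₀ S₁ ∧
      (∀ τ ∈ S₀, ∫ U, f U ∂(ymSpecification ρ β (regionEdges w Y) (splice w cs σW τ)) ≤ 1 / 3) ∧
      (∀ τ ∈ S₁, 2 / 3 ≤ ∫ U, f U ∂(ymSpecification ρ β (regionEdges w Y) (splice w cs σW τ)))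

/-- **Boundary-order wire** for the Wilson kernels of `ρ` (hypothesis H of the Q-g18 memo): one rarity
level `δ > 0` and thresholds `b₀, β₀` beyond which `WireAt ρ β b n δ` holds for every cell size `b ≥ b₀`,
every `β ≥ β₀` and every window radius `n ≥ 1`. -/
def BoundaryOrderWire {N : ℕ} (ρ : G →* Matrix (Fin N) (Fin N) ℂ) : Prop :=
  ∃ δ : ℝ, 0 < δ ∧ ∃ (b₀ : ℕ) (β₀ : ℝ),
    ∀ b : ℕ, b₀ ≤ b → ∀ β : ℝ, β₀ ≤ β → ∀ n : ℕ, 1 ≤ n → WireAt ρ β b n δ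

/-! ## §3 The wire kills the outer-tempered condition and the certificate -/

omit [IsTopologicalGroup G] [CompactSpace G] [BorelSpace G] in
/-- Distinct cells of a frame (non-negative mesh) have disjoint edge sets. -/
theorem not_mem_cellEdges_of_ne {b : ℕ} {w : Fin 4 → ℤ → ℤ}
    (hw : ∀ i j, w i j + ((b : ℕ) : ℤ) ≤ w i (j + 1) ∧ w i (j + 1) ≤ w i j + 2 * ((b : ℕ) : ℤ))
    {c cs : Fin 4 → ℤ} (hc : c ≠ cs) {e : Literature.MathematicalPhysics.QuantumLattice.ZdEdge 4} (he : e ∈ cellEdges w c) : e ∉ cellEdges w cs := by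
  intro he'
  have mono : ∀ i, Monotone (w i) := fun i =>
    monotone_int_of_le_succ fun j => by
      have h1 := (hw i j).1
      have h2 : (0 : ℤ) ≤ (b : ℤ) := Int.natCast_nonneg b
      omega
  simp only [cellEdges, Finset.mem_product, Fintype.mem_piFinset, Finset.mem_Ico, Finset.mem_univ,
    and_true] at he he'
  obtain ⟨i, hi⟩ := Function.ne_iff.1 hc
  rcases lt_or_gt_of_ne hi with h | h
  · have h1 := (he i).2
    have h2 := (he' i).1
    have h3 : w i (c i + 1) ≤ w i (cs i) := mono i (by omega)
    omega
  · have h1 := (he' i).2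
    have h2 := (he i).1
    have h3 : w i (cs i + 1) ≤ w i (c i) := mono i (by omega)
    omega

/-- **The wire at one point kills the outer-tempered condition there** (any `ε < 1/3`). -/
theorem not_outerTemperedCond_of_wireAt {N : ℕ} {ρ : G →* Matrix (Fin N) (Fin N) ℂ} {β : ℝ} {b n : ℕ}
    {ε δ : ℝ} (hW : WireAt ρ β b n δ) (hε : ε < 1 / 3) : ¬ OuterTemperedCond ρ β b n ε δ := by
  intro hO
  obtain ⟨w, hw, Y, cs, σW, f, E₀, ζ₀, S₀, S₁, hY, h0Y, hcs₁, hcs₂, hfcyl, hfmeas, hf01, hE₀, hS₀, hS₁,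
    hlo, hhi⟩ := hW
  obtain ⟨Good, -, hGdep, hmix, hrare⟩ := hO w hw
  -- (ii) forces `Good cs` to meet every set of kernel mass `> δ`
  have meet : ∀ S : Set (LGConfig 4 G), ENNReal.ofReal δ < ymSpecification ρ β E₀ ζ₀ S →
      ∃ τ ∈ S, τ ∈ Good cs := by
    intro S hS
    by_contra h
    have hsub : S ⊆ (Good cs)ᶜ := fun τ hτ hτG => h ⟨τ, hτ, hτG⟩
    exact lt_irrefl _ (lt_of_lt_of_le hS ((measure_mono hsub).trans (hrare cs E₀ hE₀ ζ₀)))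
  obtain ⟨τ₀, hτ₀S, hτ₀G⟩ := meet S₀ hS₀
  obtain ⟨τ₁, hτ₁S, hτ₁G⟩ := meet S₁ hS₁
  have hsp_in : ∀ τ : LGConfig 4 G, ∀ e ∈ cellEdges w cs, splice w cs σW τ e = τ e :=
    fun τ e he => by simp [splice, he]
  have hsp_out : ∀ τ : LGConfig 4 G, ∀ e, e ∉ cellEdges w cs → splice w cs σW τ e = σW e :=
    fun τ e he => by simp [splice, he]
  -- the splice of a good cap datum is good (`Good cs` is determined by the cap cell's edges)
  have good_splice : ∀ τ, τ ∈ Good cs → splice w cs σW τ ∈ Good cs := by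
    intro τ hτ
    exact (hGdep cs (fun e he => hsp_in τ e (Finset.mem_coe.1 he))).mpr hτ
  -- the two spliced data agree off `cs` and are both good on `cs`
  have hagree : ∀ c ∈ windowCellsPlus n, c ∉ Y →
      ((∀ e ∈ cellEdges w c, splice w cs σW τ₀ e = splice w cs σW τ₁ e) ∨
        (c ∉ windowCells n ∧ splice w cs σW τ₀ ∈ Good c ∧ splice w cs σW τ₁ ∈ Good c)) := by
    intro c _ _
    by_cases hccs : c = cs
    · subst hccs
      exact Or.inr ⟨hcs₂, good_splice τ₀ hτ₀G, good_splice τ₁ hτ₁G⟩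
    · exact Or.inl fun e he => by
        rw [hsp_out τ₀ e (not_mem_cellEdges_of_ne hw hccs he),
          hsp_out τ₁ e (not_mem_cellEdges_of_ne hw hccs he)]
  have key := hmix Y hY h0Y _ _ hagree f hfcyl hfmeas hf01
  have h1 := hlo τ₀ hτ₀S
  have h2 := hhi τ₁ hτ₁S
  have h3 : (1 : ℝ) / 3 ≤ |(∫ U, f U ∂(ymSpecification ρ β (regionEdges w Y) (splice w cs σW τ₀))) -
      ∫ U, f U ∂(ymSpecification ρ β (regionEdges w Y) (splice w cs σW τ₁))| := by
    rw [abs_sub_comm]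
    exact le_trans (by linarith) (le_abs_self _)
  linarith

/-- **H kills the v10 certificate**: `BoundaryOrderWire r.ρ → ¬ OuterCertificate r a` for every admissible
unit map `a` (positive, `→ 0`). -/
theorem outerCertificate_false_of_wire {r : LatticeRep G} {a : ℝ → ℝ}
    (hW : BoundaryOrderWire r.ρ) (hapos : ∀ β, 0 < a β) (ha : Tendsto a atTop (𝓝 0)) :
    ¬ OuterCertificate r a := by
  rintro ⟨ℓ, hℓ, n, ε, hn, hε0, hεM, hcert⟩
  obtain ⟨δ, hδ, b₀, β₀, hwire⟩ := hW
  obtain ⟨β₂, hβ₂⟩ := hcert δ hδ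
  -- `ε < 1/3` from `ε · M(n) < 1`, `M(n) ≥ 16`
  have h16 : 16 ≤ (4 * n + 3) ^ 4 - (4 * n + 1) ^ 4 := by
    apply Nat.le_sub_of_add_le
    calc 16 + (4 * n + 1) ^ 4
        ≤ 16 + (4 * n + 1) ^ 4 + (8 * (4 * n + 1) ^ 3 + 24 * (4 * n + 1) ^ 2 + 32 * (4 * n + 1)) :=
          Nat.le_add_right _ _
      _ = (4 * n + 3) ^ 4 := by ring
  have hM : (16 : ℝ) ≤ (((4 * n + 3) ^ 4 - (4 * n + 1) ^ 4 : ℕ) : ℝ) := by exact_mod_cast h16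
  have hε3 : ε < 1 / 3 := by nlinarith
  -- a large `β` with `⌈ℓ / a β⌉₊ ≥ b₀`
  have hc : 0 < ℓ / ((b₀ : ℝ) + 1) := div_pos hℓ (by positivity)
  obtain ⟨N₀, hN₀⟩ := eventually_atTop.1 (ha.eventually (gt_mem_nhds hc))
  set β := max (max N₀ β₀) β₂ with hβdef
  have hNβ : N₀ ≤ β := le_trans (le_max_left _ _) (le_max_left _ _)
  have hβ₀β : β₀ ≤ β := le_trans (le_max_right _ _) (le_max_left _ _)
  have hβ₂β : β₂ ≤ β := le_max_right _ _
  have hb : b₀ ≤ ⌈ℓ / a β⌉₊ := by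
    have h1 : a β < ℓ / ((b₀ : ℝ) + 1) := hN₀ β hNβ
    have h2 : ℓ / (ℓ / ((b₀ : ℝ) + 1)) < ℓ / a β := div_lt_div_of_pos_left hℓ (hapos β) h1
    have h3 : ℓ / (ℓ / ((b₀ : ℝ) + 1)) = (b₀ : ℝ) + 1 := by field_simp
    have h4 : (b₀ : ℝ) < ℓ / a β := by linarith
    exact (Nat.lt_ceil.2 h4).le
  exact not_outerTemperedCond_of_wireAt (hwire _ hb β hβ₀β n hn) hε3 (hβ₂ β hβ₂β)

end Defs

/-! ## §4 The IR-level statements -/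

/-- v10 :249, verbatim: the IR outer certificate (the open stub `stub_outerCert`'s type). -/
def IROuterCertificate : Prop :=
  ∀ (G : Type) [Group G] [TopologicalSpace G] [IsTopologicalGroup G] [CompactSpace G],
    IsCompactSimpleLieGroup G → letI : MeasurableSpace G := borel G; haveI : BorelSpace G := ⟨rfl⟩;
    ∀ (r : LatticeRep G) (a : ℝ → ℝ), (∀ β, 0 < a β) → Tendsto a atTop (𝓝 0) →
      LowerBounds G r a → OuterCertificate r a

/-- **Structural fact (why no unconditional kill exists):** a refutation of `IROuterCertificate` produces a
compact simple `G`, a lattice representation `r` and an admissible unit map `a` with `LowerBounds G r a` —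
a non-triviality witness of the NT shape. -/
theorem nt_witness_of_not_irOuterCertificate (h : ¬ IROuterCertificate) :
    ∃ (G : Type) (_ : Group G) (_ : TopologicalSpace G) (_ : IsTopologicalGroup G) (_ : CompactSpace G),
      IsCompactSimpleLieGroup G ∧ (letI : MeasurableSpace G := borel G; haveI : BorelSpace G := ⟨rfl⟩;
        ∃ (r : LatticeRep G) (a : ℝ → ℝ), (∀ β, 0 < a β) ∧ Tendsto a atTop (𝓝 0) ∧ LowerBounds G r a) := by
  classical
  by_contra hne
  refine h fun G i₁ i₂ i₃ i₄ hG => ?_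
  intro r a hapos ha hLB
  exact (hne ⟨G, i₁, i₂, i₃, i₄, hG, r, a, hapos, ha, hLB⟩).elim

/-- **#31 shape, typed:** a non-trivial `(G, r, a)` (compact simple `G`, `LowerBounds G r a`) whose Wilson
kernels carry a boundary-order wire refutes `IROuterCertificate`. -/
theorem irOuterCertificate_false_of_witness
    (h : ∃ (G : Type) (_ : Group G) (_ : TopologicalSpace G) (_ : IsTopologicalGroup G) (_ : CompactSpace G),
      IsCompactSimpleLieGroup G ∧ (letI : MeasurableSpace G := borel G; haveI : BorelSpace G := ⟨rfl⟩;
        ∃ (r : LatticeRep G) (a : ℝ → ℝ), (∀ β, 0 < a β) ∧ Tendsto a atTop (𝓝 0) ∧ LowerBounds G r a ∧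
          BoundaryOrderWire r.ρ)) :
    ¬ IROuterCertificate := by
  intro hC
  obtain ⟨G, _, _, _, _, hG, r, a, hapos, ha, hLB, hW⟩ := h
  letI : MeasurableSpace G := borel G
  haveI : BorelSpace G := ⟨rfl⟩
  exact outerCertificate_false_of_wire hW hapos ha (hC G hG r a hapos ha hLB)

/-- **`IROuterCertificate ∧ NT → False` modulo the wire for `SU(2)`** (stated as `NT → ¬ IROuterCertificate`
under H): if every lattice representation of `SU(2)` carries a boundary-order wire, the route's non-triviality
leaf `NT` refutes the v10 certificate. -/
theorem irOuterCertificate_false_of_nt_of_wireSU2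
    (hW : letI : MeasurableSpace (Matrix.specialUnitaryGroup (Fin 2) ℂ) :=
        borel (Matrix.specialUnitaryGroup (Fin 2) ℂ);
      haveI : BorelSpace (Matrix.specialUnitaryGroup (Fin 2) ℂ) := ⟨rfl⟩;
      ∀ r : LatticeRep (Matrix.specialUnitaryGroup (Fin 2) ℂ), BoundaryOrderWire r.ρ)
    (hNT : Summit.QuantumFields.YangMills.Theses.BalabanLadder.NT) : ¬ IROuterCertificate := by
  intro hC
  have hG : IsCompactSimpleLieGroup (Matrix.specialUnitaryGroup (Fin 2) ℂ) :=
    isCompactSimpleLieGroup_specialUnitaryGroup isSimpleCompactGroup_specialUnitaryGroup_holds le_rfl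
  letI : MeasurableSpace (Matrix.specialUnitaryGroup (Fin 2) ℂ) := borel _
  haveI : BorelSpace (Matrix.specialUnitaryGroup (Fin 2) ℂ) := ⟨rfl⟩
  obtain ⟨r, a, hapos, ha, hLB⟩ := hNT (Matrix.specialUnitaryGroup (Fin 2) ℂ) hG
  exact outerCertificate_false_of_wire (hW r) hapos ha (hC _ hG r a hapos ha hLB)

end Summit.QuantumFields.YangMills.Cruxes.IR.OuterCertWire

end
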